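import Literature.Topology.FourManifolds.ExoticSevenSphereTheta
import Literature.Topology.FourManifolds.ExoticSevenSphereSignature
import Literature.Topology.FourManifolds.SmoothHomologicalOrientationProofs
import HarnessLib

/-!
# spc4.S32⁻ from an invariant and an example: no Poincaré hypothesis in the signature chain

Topic `Literature/Topology/FourManifolds`; pure-proof companion of the wave-0 named fact
`Literature.Topology.FourManifolds.not_forall_nonemptyDiffeomorphSphere_seven` (**spc4.S32**, negative
part: the smooth Poincaré conjecture fails in dimension `7` — J. Milnor, *On manifolds
homeomorphic to the 7-sphere*, Ann. of Math. 64 (1956), 399–405, Thm. 3, p. 403: "For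
`k² ≢ 1 mod 7` the manifold `M⁷ₖ` is homeomorphic to `S⁷` but not diffeomorphic to `S⁷`").
Everything here is **proved**; no definition, no named fact, no statement of the tree is added or
changed (D-0026).

## What this file adds

Milnor's proof that `M⁷ₖ ≇ S⁷` has the shape *invariant + example*: §1, Thm. 1 — the residue
`λ(M⁷) = 2q(B⁸) - τ(B⁸) mod 7` of a closed oriented `M⁷` (with `H³ = H⁴ = 0`) does not depend on
the cobounding `B⁸` (Thom, and Hirzebruch's `τ = (7p₂ - p₁²)/45` for closed `8`-manifolds, p. 400);
§3, Lemma 4 — `λ(M⁷ₖ) ≡ k² - 1`; and `λ(S⁷) = 0`. The tree's rendering of this architecture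
(`ExoticSevenSphereSignature.lean`) replaces `λ` by Kervaire–Milnor's `σ(M) mod σ₂`, the signature of
an s-parallelizable `M⁸` bounded by the sphere (*Groups of homotopy spheres I* (1963), §7, p. 529),
with the two named facts

* **invariance** `HomotopySphere.twoHundredTwentyFour_dvd_of_mem_signatureSet_sphere` (`224 ∣ σ(M₀)`
  whenever `bM₀ = S⁷`, the standard sphere with any orientation; Kervaire–Milnor pp. 529–530,
  Kosinski 1993, IX.8.7), and
* **example** `HomotopySphere.exists_eight_mem_signatureSet` (some homotopy `7`-sphere bounds an
  s-parallelizable `M` with `σ(M) = 8`: Milnor's `E₈`-plumbing, Kosinski X.6 p. 216; reduced in the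
  tree to its geometric half `HomotopySphere.exists_intersectionForm_equivalent_e8Form` by
  `σ(E₈) = 8`, `signature_e8Form_holds`),

but it derives spc4.S32⁻ through spc4.S12 (`exists_homeomorph_isEmpty_diffeomorph_sphere_seven`:
"homeomorphic, not diffeomorphic"), and therefore also consumes Milnor's Prop. B / Smale
(`nonempty_homeomorph_sphere_of_homologySphere_of_five_le`, the h-cobordism theorem):
`not_forall_nonemptyDiffeomorphSphere_seven_of_three_leaves` (and `…_of_signature_leaves`, with
Bredon's VI.7.15 as a fourth hypothesis, now the tree theorem
`SmoothOrientation.existsUnique_isCompatible_holds`); likewise the tree's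
`nontrivial_homotopySphereClass_seven_of_signature_leaves` (`Θ₇ ≠ 0`) consumes Prop. B and
Kervaire–Milnor's Thm. 7.5.

For spc4.S32⁻ no Poincaré-type input is needed: Mathlib's `NonemptyDiffeomorphSphere M 7` asks for
a diffeomorphism from a mere *homotopy equivalence* `M ≃ₕ 𝕊⁷`, which every homotopy sphere has by
definition. Hence:

* `not_forall_nonemptyDiffeomorphSphere_seven_of_mem_signatureSet_of_forall_dvd` — **Milnor's
  architecture, unconditionally**: if every signature `σ(M₀)` of an s-parallelizable `M₀` bounded
  by the standard `𝕊⁷` (any orientation) is divisible by some `d`, and some homotopy `7`-sphere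
  `Σ` bounds an s-parallelizable `M` with `d ∤ σ(M)`, then spc4.S32⁻. (Milnor: `d = 7`; Kervaire–
  Milnor: `d = σ₂ = 224`.) Proof: a diffeomorphism `Σ ≅ 𝕊⁷` would transport `(M, σ(M))` to the
  standard sphere (`HomotopySphere.exists_mem_signatureSet_sphere_of_diffeomorph`, proved in
  `ExoticSevenSphereSignature.lean`, fed with Bredon's VI.7.15, now the tree theorem
  `SmoothOrientation.existsUnique_isCompatible_holds`), forcing `d ∣ σ(M)`.
* `HomotopySphereClass.mk_ne_mk_sphere_of_mem_signatureSet_of_forall_dvd` — under the same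
  hypotheses `[Σ] ≠ [𝕊⁷, o]` in `Θ₇` for every orientation `o`, and
  `nontrivial_homotopySphereClass_seven_of_mem_signatureSet_of_forall_dvd` — `Θ₇` is nontrivial.
* `not_forall_nonemptyDiffeomorphSphere_seven_of_exists_eight_of_dvd` — **spc4.S32⁻ from the two
  named leaves alone** (example `exists_eight_mem_signatureSet` + invariance
  `twoHundredTwentyFour_dvd_of_mem_signatureSet_sphere`; `224 ∤ 8`), and
  `not_forall_nonemptyDiffeomorphSphere_seven_of_e8Form_of_dvd` — the same from the plumbing leaf
  `exists_intersectionForm_equivalent_e8Form`;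
* `nontrivial_homotopySphereClass_seven_of_exists_eight_of_dvd` — `Θ₇ ≠ 0` from the same two
  leaves (no Prop. B, no Thm. 7.5; improves `nontrivial_homotopySphereClass_seven_of_signature_leaves`);
* `exists_homeomorph_isEmpty_diffeomorph_sphere_seven_of_exists_eight_of_dvd_of_five_le` — spc4.S12
  from the two leaves and the topological Poincaré conjecture `nonempty_homeomorph_sphere_of_five_le`
  (the Prop. B form being the tree's `exists_homeomorph_isEmpty_diffeomorph_sphere_seven_of_three_leaves`).

Net effect on the debt behind spc4.S32⁻ on the signature route: exactly the two halves of
Milnor's proof — `exists_intersectionForm_equivalent_e8Form` (the example, §3–4 / Kosinski VI.12)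
and `twoHundredTwentyFour_dvd_of_mem_signatureSet_sphere` (the invariance, §1 / signature theorem) —
and nothing of Poincaré-conjecture type.

## References

* J. Milnor, *On manifolds homeomorphic to the 7-sphere*, Ann. of Math. 64 (1956), 399–405: §1,
  Thm. 1 and Cor. 1 (p. 399), proof p. 400 (signature theorem `τ(C⁸) = (7p₂ - p₁²)/45`); §3,
  Lemmas 3–4 and Thm. 3 (pp. 402–403). doi:10.2307/1969983 [Milnor1956]
* M. Kervaire, J. Milnor, *Groups of homotopy spheres I*, Ann. of Math. 77 (1963), 504–537: §1–2
  (pp. 504–507: `Θₙ`), §7 (pp. 528–531: `σ(M)`, `σₘ`, Thm. 7.5). [KervaireMilnorAnnals1963]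
* A. Kosinski, *Differential Manifolds* (1993): VI.12, IX.8.7, X §6 (pp. 216–217). [Kosinski1993]
* G. Bredon, *Topology and Geometry* (1993), VI.7, Thm. 7.15. [Bredon1993]
-/

open scoped Manifold ContDiff Topology
open Set Function

noncomputable section

namespace Literature.Topology.FourManifolds

/-! ### Milnor's architecture: an invariant of the standard sphere and one example give spc4.S32⁻ -/

/-- **Invariant + example ⟹ the smooth Poincaré conjecture fails in dimension `7`** (Milnor 1956:
§1 Thm. 1, the invariance of `λ mod 7`; §3 Lemma 4 and Thm. 3, an example with `λ ≠ 0 = λ(S⁷)`;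
here with Kervaire–Milnor's `σ(M)`, 1963, §7, p. 529, in place of `λ`). Fix a generator convention
`g` and `d : ℤ`. If every signature `τ = σ(M₀)` of an oriented s-parallelizable `8`-manifold `M₀`
bounded by the standard sphere `𝕊⁷` (with any smooth orientation `o`) is divisible by `d`, and some
homotopy `7`-sphere `Σ` bounds an oriented s-parallelizable `M` with `σ(M) = σ`, `d ∤ σ`, then not
every Hausdorff second countable smooth `7`-manifold homotopy equivalent to `𝕊⁷` is diffeomorphic
to it: `Σ` is such a manifold, and a diffeomorphism `ψ : Σ ≅ 𝕊⁷` would make `σ` a signature for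
the standard sphere (`HomotopySphere.exists_mem_signatureSet_sphere_of_diffeomorph`: transport of
the bounding datum along `ψ`, its Bredon hypothesis fed by the tree theorem
`SmoothOrientation.existsUnique_isCompatible_holds`), whence `d ∣ σ`. No Poincaré-conjecture input. [cite: Milnor1956, §1 Thm. 1 (p. 399) and §3 Thm. 3 (p. 403)] [cite: KervaireMilnorAnnals1963, §7, p. 529 (σ(M₀), σₘ)] -/
theorem not_forall_nonemptyDiffeomorphSphere_seven_of_mem_signatureSet_of_forall_dvd
    {g : Literature.AlgebraicTopology.SingularHomology.HomologicalOrientation ℤ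
      (EuclideanSpace ℝ (Fin 7)) 7}
    {h : 7 + 1 = 4 * 2} {d σ : ℤ}
    (hinv : ∀ (o : SmoothOrientation (𝓡 7) (Metric.sphere (0 : EuclideanSpace ℝ (Fin 8)) 1))
      (τ : ℤ), τ ∈ HomotopySphere.signatureSet g 2 h
        ⟨Metric.sphere (0 : EuclideanSpace ℝ (Fin 8)) 1, o, ⟨.refl _⟩⟩ → d ∣ τ)
    {S : HomotopySphere 7} (hσ : σ ∈ HomotopySphere.signatureSet g 2 h S) (hd : ¬ d ∣ σ) :
    not_forall_nonemptyDiffeomorphSphere_seven := by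
  refine not_forall_nonemptyDiffeomorphSphere_seven_of_homotopySphere S ⟨fun ψ => hd ?_⟩
  obtain ⟨o, ho⟩ := HomotopySphere.exists_mem_signatureSet_sphere_of_diffeomorph (by norm_num)
    SmoothOrientation.existsUnique_isCompatible_holds hσ ψ
  exact hinv o σ ho

/-- **Invariant + example ⟹ `[Σ] ≠ [𝕊⁷]` in `Θ₇`** (Kervaire–Milnor 1963, §7, p. 529–530: `σ(M)`
`mod σₘ` separates classes; Milnor 1956, Thm. 1 / Thm. 3 with `λ`). Under the hypotheses of
`not_forall_nonemptyDiffeomorphSphere_seven_of_mem_signatureSet_of_forall_dvd`, the class of `Σ` in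
`Θ₇ = HomotopySphereClass 7` differs from that of the standard sphere with any orientation `o`:
equal classes are oriented-diffeomorphic (`HomotopySphereClass.exact`), and a diffeomorphism
`Σ ≅ 𝕊⁷` would force `d ∣ σ` as above. [cite: KervaireMilnorAnnals1963, §7, pp. 529–530] [cite: Milnor1956, §1 Thm. 1 (p. 399) and §3 Thm. 3 (p. 403)] -/
theorem HomotopySphereClass.mk_ne_mk_sphere_of_mem_signatureSet_of_forall_dvd
    {g : Literature.AlgebraicTopology.SingularHomology.HomologicalOrientation ℤ
      (EuclideanSpace ℝ (Fin 7)) 7}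
    {h : 7 + 1 = 4 * 2} {d σ : ℤ}
    (hinv : ∀ (o : SmoothOrientation (𝓡 7) (Metric.sphere (0 : EuclideanSpace ℝ (Fin 8)) 1))
      (τ : ℤ), τ ∈ HomotopySphere.signatureSet g 2 h
        ⟨Metric.sphere (0 : EuclideanSpace ℝ (Fin 8)) 1, o, ⟨.refl _⟩⟩ → d ∣ τ)
    {S : HomotopySphere 7} (hσ : σ ∈ HomotopySphere.signatureSet g 2 h S) (hd : ¬ d ∣ σ)
    (o : SmoothOrientation (𝓡 7) (Metric.sphere (0 : EuclideanSpace ℝ (Fin 8)) 1)) :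
    HomotopySphereClass.mk S ≠ HomotopySphereClass.mk (HomotopySphere.sphere o) := by
  intro hST
  obtain ⟨ψ, -⟩ := HomotopySphereClass.exact hST
  obtain ⟨o', ho'⟩ := HomotopySphere.exists_mem_signatureSet_sphere_of_diffeomorph (by norm_num)
    SmoothOrientation.existsUnique_isCompatible_holds hσ ψ
  exact hd (hinv o' σ ho')

/-- **Invariant + example ⟹ `Θ₇ ≠ 0`** (Kervaire–Milnor 1963, p. 504: "Milnor [15] showed that
`Θ₇ ≠ 0`"): under the hypotheses of
`not_forall_nonemptyDiffeomorphSphere_seven_of_mem_signatureSet_of_forall_dvd`, `Θ₇` has two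
distinct elements, `[Σ]` and `[𝕊⁷, o₀]`
(`HomotopySphereClass.mk_ne_mk_sphere_of_mem_signatureSet_of_forall_dvd`; `𝕊⁷` is orientable,
`isOrientable_sphere_holds`). [cite: KervaireMilnorAnnals1963, §1 (p. 504) and §7 (pp. 529–530)] -/
theorem nontrivial_homotopySphereClass_seven_of_mem_signatureSet_of_forall_dvd
    {g : Literature.AlgebraicTopology.SingularHomology.HomologicalOrientation ℤ
      (EuclideanSpace ℝ (Fin 7)) 7}
    {h : 7 + 1 = 4 * 2} {d σ : ℤ}
    (hinv : ∀ (o : SmoothOrientation (𝓡 7) (Metric.sphere (0 : EuclideanSpace ℝ (Fin 8)) 1))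
      (τ : ℤ), τ ∈ HomotopySphere.signatureSet g 2 h
        ⟨Metric.sphere (0 : EuclideanSpace ℝ (Fin 8)) 1, o, ⟨.refl _⟩⟩ → d ∣ τ)
    {S : HomotopySphere 7} (hσ : σ ∈ HomotopySphere.signatureSet g 2 h S) (hd : ¬ d ∣ σ) :
    Nontrivial (HomotopySphereClass 7) := by
  obtain ⟨o₀⟩ := (isOrientable_sphere_holds 7 : Nonempty _)
  exact ⟨⟨HomotopySphereClass.mk S, HomotopySphereClass.mk (HomotopySphere.sphere o₀),
    HomotopySphereClass.mk_ne_mk_sphere_of_mem_signatureSet_of_forall_dvd hinv hσ hd o₀⟩⟩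

/-! ### spc4.S32⁻ and `Θ₇ ≠ 0` from the two named leaves alone -/

/-- **spc4.S32⁻ from the example leaf and the invariance leaf, nothing else.** GIVEN
(i) `HomotopySphere.exists_eight_mem_signatureSet` (some homotopy `7`-sphere bounds an oriented
s-parallelizable `8`-manifold of signature `8` — Milnor's `E₈`-plumbing; Kosinski 1993, X.6,
p. 216) and (ii) `HomotopySphere.twoHundredTwentyFour_dvd_of_mem_signatureSet_sphere` (every such
signature for the standard `𝕊⁷` is a multiple of `σ₂ = 224` — signature theorem; Kervaire–Milnor
1963, pp. 529–530; Kosinski IX.8.7), the smooth Poincaré conjecture fails in dimension `7`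
(`not_forall_nonemptyDiffeomorphSphere_seven`; Milnor 1956, Thm. 3), since `224 ∤ 8`
(`not_forall_nonemptyDiffeomorphSphere_seven_of_mem_signatureSet_of_forall_dvd`). Compared with
`not_forall_nonemptyDiffeomorphSphere_seven_of_three_leaves` (`ExoticSevenSphereSignature.lean`) the
hypothesis Prop. B (`nonempty_homeomorph_sphere_of_homologySphere_of_five_le`, the h-cobordism
theorem) is gone. When the two leaves are discharged,
`not_forall_nonemptyDiffeomorphSphere_seven_holds` is this theorem applied to their `_holds`. [cite: Milnor1956, Thm. 3 (p. 403), with §1 Thm. 1] [cite: KervaireMilnorAnnals1963, §7, pp. 529–530] -/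
theorem not_forall_nonemptyDiffeomorphSphere_seven_of_exists_eight_of_dvd
    (hE8 : HomotopySphere.exists_eight_mem_signatureSet)
    (h224 : HomotopySphere.twoHundredTwentyFour_dvd_of_mem_signatureSet_sphere) :
    not_forall_nonemptyDiffeomorphSphere_seven := by
  obtain ⟨g⟩ := isOrientableOver_int_euclideanSpace 7
  have h : (7 : ℕ) + 1 = 4 * 2 := by norm_num
  obtain ⟨S, hS⟩ := hE8 7 2 h (by norm_num) g
  exact not_forall_nonemptyDiffeomorphSphere_seven_of_mem_signatureSet_of_forall_dvd (h224 g h) hS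
    (by decide)

/-- **spc4.S32⁻ from the plumbing leaf and the invariance leaf**: as
`not_forall_nonemptyDiffeomorphSphere_seven_of_exists_eight_of_dvd`, with "`8` occurs" replaced by
its geometric half `HomotopySphere.exists_intersectionForm_equivalent_e8Form` (Milnor's plumbing
`M(8)` bounds a homotopy sphere, is s-parallelizable and has intersection form `E₈`; Kosinski 1993,
VI.12 and IX.7.5), the algebraic half `σ(E₈) = 8` being the tree theorem `signature_e8Form_holds`
(`HomotopySphere.exists_eight_mem_signatureSet_of`). These two hypotheses are the whole remaining
debt behind spc4.S32⁻ on the signature route. [cite: Milnor1956, Thm. 3 (p. 403)] [cite: Kosinski1993, VI.12 and Ch. X §6, proof of Prop. 6.2(a) (p. 216)] -/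
theorem not_forall_nonemptyDiffeomorphSphere_seven_of_e8Form_of_dvd
    (hΓ : HomotopySphere.exists_intersectionForm_equivalent_e8Form)
    (h224 : HomotopySphere.twoHundredTwentyFour_dvd_of_mem_signatureSet_sphere) :
    not_forall_nonemptyDiffeomorphSphere_seven :=
  not_forall_nonemptyDiffeomorphSphere_seven_of_exists_eight_of_dvd
    (HomotopySphere.exists_eight_mem_signatureSet_of hΓ signature_e8Form_holds) h224

/-- **`Θ₇ ≠ 0` from the example leaf and the invariance leaf, nothing else** (Kervaire–Milnor 1963,
p. 504: "Milnor [15] showed that `Θ₇ ≠ 0`"): GIVEN `HomotopySphere.exists_eight_mem_signatureSet`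
and `HomotopySphere.twoHundredTwentyFour_dvd_of_mem_signatureSet_sphere`, `Θ₇ = HomotopySphereClass 7`
is nontrivial. Improves `nontrivial_homotopySphereClass_seven_of_signature_leaves`
(`ExoticSevenSphereSignature.lean`), which also consumes Kervaire–Milnor's Thm. 7.5 and Milnor's
Prop. B. [cite: KervaireMilnorAnnals1963, §1 (p. 504) and §7 (pp. 529–530)] [cite: Milnor1956, Thm. 3 (p. 403)] -/
theorem nontrivial_homotopySphereClass_seven_of_exists_eight_of_dvd
    (hE8 : HomotopySphere.exists_eight_mem_signatureSet)
    (h224 : HomotopySphere.twoHundredTwentyFour_dvd_of_mem_signatureSet_sphere) :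
    Nontrivial (HomotopySphereClass 7) :=
  nontrivial_homotopySphereClass_seven_of_not_forall
    (not_forall_nonemptyDiffeomorphSphere_seven_of_exists_eight_of_dvd hE8 h224)

/-- **`Θ₇ ≠ 0` from the plumbing leaf and the invariance leaf**: as
`nontrivial_homotopySphereClass_seven_of_exists_eight_of_dvd`, from
`HomotopySphere.exists_intersectionForm_equivalent_e8Form` and `σ(E₈) = 8` (`signature_e8Form_holds`).
[cite: KervaireMilnorAnnals1963, §1 (p. 504) and §7 (pp. 529–530)] [cite: Kosinski1993, VI.12 and Ch. X §6 (p. 216)] -/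
theorem nontrivial_homotopySphereClass_seven_of_e8Form_of_dvd
    (hΓ : HomotopySphere.exists_intersectionForm_equivalent_e8Form)
    (h224 : HomotopySphere.twoHundredTwentyFour_dvd_of_mem_signatureSet_sphere) :
    Nontrivial (HomotopySphereClass 7) :=
  nontrivial_homotopySphereClass_seven_of_not_forall
    (not_forall_nonemptyDiffeomorphSphere_seven_of_e8Form_of_dvd hΓ h224)

/-! ### spc4.S12 from the two leaves and one Poincaré-type input -/

/-- **Milnor's exotic `7`-sphere from the two signature leaves and the topological Poincaré
conjecture in dimensions `≥ 5`** (`nonempty_homeomorph_sphere_of_five_le`, spc4.S14; Smale 1961 /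
Newman–Connell): `Θ₇ ≠ 0` by `nontrivial_homotopySphereClass_seven_of_exists_eight_of_dvd`, then
`exists_homeomorph_isEmpty_diffeomorph_sphere_seven_of_nontrivial` (`ExoticSevenSphere.lean`).
[cite: Milnor1956, Thm. 3 (p. 403)] -/
theorem exists_homeomorph_isEmpty_diffeomorph_sphere_seven_of_exists_eight_of_dvd_of_five_le
    (hE8 : HomotopySphere.exists_eight_mem_signatureSet)
    (h224 : HomotopySphere.twoHundredTwentyFour_dvd_of_mem_signatureSet_sphere)
    (hTop : nonempty_homeomorph_sphere_of_five_le.{0}) :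
    exists_homeomorph_isEmpty_diffeomorph_sphere_seven :=
  exists_homeomorph_isEmpty_diffeomorph_sphere_seven_of_nontrivial
    (nontrivial_homotopySphereClass_seven_of_exists_eight_of_dvd hE8 h224) hTop

/-! ### Fact decomposition record (librarian `fact-decompose`, 2026-08-16) -/

/-- **Assembly of the split of spc4.S32⁻ `not_forall_nonemptyDiffeomorphSphere_seven`**
(budget-capped fact, human ruling 2026-08-16), along Milnor's architecture *invariant + example*
(1956, §1 Thm. 1 and §3 Thm. 3): the two children are the tree's two named signature leaves —
the EXAMPLE in its geometric half, `HomotopySphere.exists_intersectionForm_equivalent_e8Form`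
(Milnor's `E₈`-plumbing `M(8)` bounds a homotopy `7`-sphere, is s-parallelizable and has
intersection form `E₈`; Kosinski 1993, VI.12 and IX.7.5; the algebraic half `σ(E₈) = 8` is the
theorem `signature_e8Form_holds`), and the INVARIANCE
`HomotopySphere.twoHundredTwentyFour_dvd_of_mem_signatureSet_sphere` (every signature of an
s-parallelizable `M₀⁸` bounded by the standard `𝕊⁷` is a multiple of `σ₂ = 224`: signature theorem,
Bott integrality, `ker J₇`; Kervaire–Milnor 1963, pp. 529–530; Kosinski IX.8.7); the glue is
`not_forall_nonemptyDiffeomorphSphere_seven_of_e8Form_of_dvd` (`224 ∤ 8`; no Poincaré-type input).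
[cite: Milnor1956, Thm. 3 (p. 403), with §1 Thm. 1] [cite: KervaireMilnorAnnals1963, §7, pp. 529–530]
[cite: Kosinski1993, VI.12, IX.8.7 and Ch. X §6 (p. 216)] -/
theorem not_forall_nonemptyDiffeomorphSphere_seven_holds_of :
    HomotopySphere.exists_intersectionForm_equivalent_e8Form →
      HomotopySphere.twoHundredTwentyFour_dvd_of_mem_signatureSet_sphere →
        not_forall_nonemptyDiffeomorphSphere_seven :=
  fun hΓ h224 => not_forall_nonemptyDiffeomorphSphere_seven_of_e8Form_of_dvd hΓ h224

end Literature.Topology.FourManifolds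

end
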